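import Summits.HodgeConjecture.HodgeConjecture.Theses.BoundaryReadout
import Literature.AlgebraicGeometry.HodgeTheory.ClassesSupportedOnComplexification
import Literature.AlgebraicGeometry.HodgeTheory.RationalLattice
import HarnessLib

/-!
# Route BoundaryReadout — crux `BoundaryAbsoluteness`, line `typewise_readout`:
# stub `stub_rationalDescent` — rationality descends along a kernel inclusion

The crux `BoundaryAbsoluteness` (stmt-HodgeConjecture-15913) of the route `BoundaryReadout` is cut, in
the line `typewise_readout` (skeleton `Cruxes/BoundaryAbsoluteness/Lines/typewise_readout.lean`), into
five registered stubs; this file proves the third one, the σ-free, curve-free LINEAR ALGEBRA on ONE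
smooth projective complex variety `X`:

> for finitely many `h_i : Y_i ⟶ X` and `w : W ⟶ X` with `⋂ᵢ ker h_i^* ⊆ ker w^*` on `Hᵏ(X(ℂ); ℂ)`,
> a complex class `Θ` all of whose pull-backs `h_i^* Θ` are rational has `w^* Θ` rational.

Proof (Deligne 1982, Lemma 2.13 `(V ⊗ Z) ∩ W = V`; Voisin I §7.1.1 `Hᵏ(X, ℚ) ⊗ ℂ = Hᵏ(X, ℂ)`;
Hatcher §3.1 p. 198, change of coefficients). Write `β_T : ℂ ⊗_ℚ Hᵏ(T; ℚ) → Hᵏ(T; ℂ)` for the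
complexification of the rational lattice (the tree's `Motives.ofRatClassBaseChange`): it is injective
for every space (`ofRatClassBaseChange_injective`), onto for `X` smooth projective
(`ofRatClassBaseChange_surjective`), and natural (`map_ofRatClassBaseChange`:
`g^* ∘ β_X = β_Y ∘ (g^*_ℚ ⊗ 1)`). Choose a `ℚ`-linear retraction `ρ : ℂ → ℚ` of `ℚ ↪ ℂ`
(`ratRetraction`). For `Θ = β_X(t)` put `θ₀ := (ρ ⊗ 1)(t) ⊗ 1 ∈ Hᵏ(X(ℂ); ℂ)`, a RATIONAL class. If
`h_i^* Θ = a_i ⊗ 1` is rational, then `(h_i^*_ℚ ⊗ 1)(t) = 1 ⊗ a_i` by injectivity of `β_{Y_i}`, and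
since `ρ ⊗ 1` commutes with `h_i^*_ℚ ⊗ 1` (`rationalDescent_apply_lid_rTensor_eq`),
`h_i^*_ℚ((ρ ⊗ 1) t) = (ρ ⊗ 1)(1 ⊗ a_i) = a_i`, i.e. `h_i^* θ₀ = h_i^* Θ` SIMULTANEOUSLY for all `i`
(`exists_isRationalClass_forall_map_eq` — the family version of the tree's one-morphism
`exists_isRationalClass_complexBetti_map_eq`; no finiteness of the index set is needed). Hence
`h_i^*(Θ - θ₀) = 0` for all `i`, so `w^*(Θ - θ₀) = 0` by the kernel inclusion, and
`w^* Θ = w^* θ₀` is rational (`IsRationalClass.pullback`).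

## References

* P. Deligne, *Hodge cycles on abelian varieties*, LNM 900 (1982), §2 Lemma 2.13. [Deligne1982HodgeCycles]
* C. Voisin, *Hodge Theory and Complex Algebraic Geometry I* (2002), §7.1.1. [VoisinHodgeI2002]
* A. Hatcher, *Algebraic Topology* (2002), §3.1 p. 198. [HatcherAT2002]
-/

set_option linter.dupNamespace false

noncomputable section

open scoped TensorProduct
open CategoryTheory
open Literature.AlgebraicGeometry.Motives Literature.AlgebraicGeometry.HodgeTheory
open Literature.AlgebraicTopology.SingularHomology

universe u

namespace Summit.HodgeConjecture.HodgeConjecture.Theorems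

/-- **`ρ ⊗ 1` commutes with base-changed maps.** For a `ℚ`-linear retraction `ρ : ℂ → ℚ`
(`ρ 1 = 1`), a `ℚ`-linear `f : V → W` and `t ∈ ℂ ⊗_ℚ V` with `(f ⊗ 1)(t) = 1 ⊗ a`:
`f((ρ ⊗ 1) t) = (ρ ⊗ 1)((f ⊗ 1) t) = (ρ ⊗ 1)(1 ⊗ a) = a` — a `ℚ`-linear system with a complex solution
`t` has the rational solution `(ρ ⊗ 1) t` (Deligne 1982, Lemma 2.13: `(V ⊗ Z) ∩ W = V`).
[cite: Deligne1982HodgeCycles, §2 Lemma 2.13] -/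
theorem rationalDescent_apply_lid_rTensor_eq {V W : Type*} [AddCommGroup V] [Module ℚ V]
    [AddCommGroup W] [Module ℚ W] (ρ : ℂ →ₗ[ℚ] ℚ) (hρ : ρ 1 = 1) (f : V →ₗ[ℚ] W)
    (t : ℂ ⊗[ℚ] V) (a : W) (ht : f.baseChange ℂ t = (1 : ℂ) ⊗ₜ[ℚ] a) :
    f (TensorProduct.lid ℚ V (ρ.rTensor V t)) = a := by
  have hnat : ∀ s : ℂ ⊗[ℚ] V, f (TensorProduct.lid ℚ V (ρ.rTensor V s)) =
      TensorProduct.lid ℚ W (ρ.rTensor W (f.baseChange ℂ s)) := by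
    intro s
    induction s using TensorProduct.induction_on with
    | zero => simp only [map_zero]
    | tmul c v =>
      simp only [LinearMap.rTensor_tmul, TensorProduct.lid_tmul, map_smul,
        LinearMap.baseChange_tmul]
    | add x y hx hy => simp only [map_add, hx, hy]
  rw [hnat, ht, LinearMap.rTensor_tmul, hρ, TensorProduct.lid_tmul, one_smul]

/-- **Simultaneous rational lift along a family of continuous maps.** Let `X` be a space whose
complexification `β_X : ℂ ⊗_ℚ Hᵏ(X; ℚ) → Hᵏ(X; ℂ)` is onto (e.g. `X = 𝒳(ℂ)` for `𝒳` smooth projective,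
`ofRatClassBaseChange_surjective`; Voisin I §7.1.1), `g_i : Y_i → X` any family of continuous maps,
and `Θ ∈ Hᵏ(X; ℂ)` a class all of whose pull-backs `g_i^* Θ` are rational. Then there is ONE rational
class `θ₀ ∈ Hᵏ(X; ℂ)` with `g_i^* θ₀ = g_i^* Θ` for all `i`: `θ₀ = (ρ ⊗ 1)(t) ⊗ 1` for `Θ = β_X(t)` and a
`ℚ`-linear retraction `ρ` of `ℚ ↪ ℂ`, using injectivity and naturality of `β_{Y_i}`
(`ofRatClassBaseChange_injective`, `map_ofRatClassBaseChange`; Hatcher §3.1 p. 198). The family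
version of the tree's `exists_isRationalClass_complexBetti_map_eq`.
[cite: VoisinHodgeI2002, §7.1.1] [cite: HatcherAT2002, §3.1 p. 198]
[cite: Deligne1982HodgeCycles, §2 Lemma 2.13] -/
theorem exists_isRationalClass_forall_map_eq {X : Type u} [TopologicalSpace X] {k : ℕ}
    (hsurj : Function.Surjective (ofRatClassBaseChange X k)) {ι : Type*} {Y : ι → Type u}
    [∀ i, TopologicalSpace (Y i)] (g : ∀ i, C(Y i, X)) (Θ : singularCohomology ℂ ℂ X k)
    (hΘ : ∀ i, IsRationalClass (singularCohomology.map ℂ ℂ (g i) k Θ)) :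
    ∃ θ₀ : singularCohomology ℂ ℂ X k, IsRationalClass θ₀ ∧
      ∀ i, singularCohomology.map ℂ ℂ (g i) k θ₀ = singularCohomology.map ℂ ℂ (g i) k Θ := by
  -- the `ℚ`-linear retraction `ρ` of `ℚ ↪ ℂ` fixes `1`
  have hρ : ratRetraction (1 : ℂ) = 1 := by
    have h := ratRetraction_ratCast 1
    rwa [Rat.cast_one] at h
  obtain ⟨t, rfl⟩ := hsurj Θ
  refine ⟨ofRatClass X k (TensorProduct.lid ℚ (singularCohomology ℚ ℚ X k)
      (ratRetraction.rTensor (singularCohomology ℚ ℚ X k) t)), isRationalClass_ofRatClass _,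
    fun i => ?_⟩
  obtain ⟨a, ha⟩ := (isRationalClass_iff_mem_range_ofRatClass _).1 (hΘ i)
  rw [map_ofRatClassBaseChange] at ha ⊢
  -- `(g_i^* ⊗ 1) t = 1 ⊗ a_i` by injectivity of `β_{Y_i}`
  have hta : (singularCohomology.map ℚ ℚ (g i) k).hom.baseChange ℂ t = (1 : ℂ) ⊗ₜ[ℚ] a := by
    apply ofRatClassBaseChange_injective (Y i) k
    rw [← ha, ofRatClassBaseChange_tmul, one_smul]
  rw [← ofRatClass_map, hta, ofRatClassBaseChange_tmul, one_smul]
  congr 1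
  exact rationalDescent_apply_lid_rTensor_eq ratRetraction hρ _ t a hta

/-- **STUB `stub_rationalDescent` of the line `typewise_readout` of the crux `BoundaryAbsoluteness`
(route `BoundaryReadout`) — rationality descends along a kernel inclusion.** For `X` smooth
projective over `ℂ`, finitely many `h_i : Y_i ⟶ X`, `w : W ⟶ X`, and a degree `k` with
`⋂ᵢ ker h_i^* ⊆ ker w^*` on `Hᵏ(X(ℂ); ℂ)`: a complex class `Θ` whose pull-backs `h_i^* Θ` are all
rational has `w^* Θ` rational. Proof: by the simultaneous rational lift
(`exists_isRationalClass_forall_map_eq`, available since `ℂ ⊗ Hᵏ(X(ℂ); ℚ) → Hᵏ(X(ℂ); ℂ)` is onto for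
`X` smooth projective, `ofRatClassBaseChange_surjective`) there is a rational `θ₀` with
`h_i^* θ₀ = h_i^* Θ` for all `i`; then `w^*(Θ - θ₀) = 0` by the kernel inclusion and `w^* Θ = w^* θ₀`
is rational (`IsRationalClass.pullback`). The smoothness hypotheses on the `Y_i` and on `W` and the
finiteness of the index set are not used. [cite: Deligne1982HodgeCycles, §2 Lemma 2.13]
[cite: VoisinHodgeI2002, §7.1.1] [cite: HatcherAT2002, §3.1 p. 198] -/
theorem stub_rationalDescent :
    ∀ ⦃n : ℕ⦄ ⦃X : SchemeOver ℂ⦄, IsSmoothProjective n X →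
      ∀ ⦃ι : Type⦄ [Finite ι] ⦃m : ι → ℕ⦄ ⦃Y : ι → SchemeOver ℂ⦄ (h : ∀ i, Y i ⟶ X),
        (∀ i, IsSmoothProjective (m i) (Y i)) →
        ∀ ⦃nW : ℕ⦄ ⦃W : SchemeOver ℂ⦄ (w : W ⟶ X), IsSmoothProjective nW W →
          ∀ (k : ℕ), (∀ x : complexBetti X k,
              (∀ i, complexBetti.map (h i) k x = 0) → complexBetti.map w k x = 0) →
            ∀ (Θ : complexBetti X k), (∀ i, IsRationalClass (complexBetti.map (h i) k Θ)) →
              IsRationalClass (complexBetti.map w k Θ) := by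
  intro n X hX ι _ m Y h _ nW W w _ k hker Θ hΘ
  -- one rational class `θ₀` with the same pull-backs to all the pieces
  obtain ⟨θ₀, hθ₀, hθ₀Θ⟩ := exists_isRationalClass_forall_map_eq
    (ofRatClassBaseChange_surjective hX k) (Y := fun i => ComplexPoints (Y i))
    (fun i => AlgPoints.mapContinuous (L := ℂ) (h i)) Θ hΘ
  -- `Θ - θ₀` dies on every piece, hence on `W`
  have hdiff : complexBetti.map w k (Θ - θ₀) = 0 :=
    hker (Θ - θ₀) fun i => by rw [map_sub, sub_eq_zero]; exact (hθ₀Θ i).symm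
  rw [map_sub, sub_eq_zero] at hdiff
  rw [hdiff]
  exact hθ₀.pullback _

end Summit.HodgeConjecture.HodgeConjecture.Theorems

end
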